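import Summits.Ventures.Crystal3D.Theorems.StickyWulffConstantCoaxialWallLawClassCollapse8
import Summits.Ventures.Crystal3D.Theorems.StickyWulffConstantCoaxialWallLawTailResidueModuleCaptureShallow
import Summits.Ventures.Crystal3D.Theorems.StickyWulffConstantCoaxialWallLawReadingDirectionsLattice
import HarnessLib

/-!
# `TailResidue.moduleCapture : ModuleCapture` — every mono-module payer window is captured (crux `CoaxialWallLaw`, stmt-Ventures-19481)

HONEST FRAMING. Venture `Summits/Ventures/Crystal3D` (cell `crystal3d-full`); helper `--supports` the crux `CoaxialWallLaw` (stmt-Ventures-19481,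
`route-Ventures-StickyWulffConstant`), registered line 'CoaxialWallLawCertificates' v3 (planner cf-p1, 2026-08-29T07:35:12Z), registered stub
`stub_moduleCapture : TailResidue.ModuleCapture` (the stub closer is a separate one-line file).  Census-free; F-C1 not moved.
THE DEEP CASE OF `ModuleCapture`, assembled from three tree facts:
(1) `…ReadingDirectionsLattice.stdFrame_of_exact_reader` — a class that fires on the exact part of a window has a STANDARD frame;
(2) `…ClassCollapse8.exists_stdFrame_adm_transfer` — all standard classes of the joint systems of the transported plate frame `L̃` are classes
    (same frame, same direction) of the joint systems of ONE standard frame `L₀`;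
(3) `…TailResidueModuleCaptureShallow.isEndMove_of_exact` (+ `mem_exactOf_iff`, `exists_slot_neg_of_adm`) — positions descend to the exact part.
* `capturedAt_of_mono_of_transfer` — the shallow lemma `capturedAt_of_mono_of_stdFrame` with `StdFrame L̃` replaced by a class transfer to `L₀`;
* **`moduleCapture : ModuleCapture`** — `MonoModuleAt L X z → CapturedAt L X z` at every off-site payer window.
WHAT THIS IS NOT: not `MultiGrainSmall`, not `LensCert`; F-C1 not moved.
-/

noncomputable section

-- the window Finsets (`siteBall`, `apexBall`) are large closed terms; unification around them needs a deeper recursion budget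
set_option maxRecDepth 65536

namespace Summit.Ventures.Crystal3D.Theorems

namespace TailResidue

open Summit.Ventures.Crystal3D Finset
open scoped InnerProductSpace

/-- **Capture from a class transfer.**  If every STANDARD admissible class of the joint systems of `L̃ = L.trans S.symm` is an admissible class of
the joint systems of the standard frame `L₀`, and the `MonoModuleAt` clause holds for the placement `S`, then the window is captured (with `S, L₀`). -/
theorem capturedAt_of_mono_of_transfer {L : EuclideanSpace ℝ (Fin 3) ≃ₗᵢ[ℝ] EuclideanSpace ℝ (Fin 3)} {X : Finset (EuclideanSpace ℝ (Fin 3))}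
    {z : EuclideanSpace ℝ (Fin 3)} (S L₀ : EuclideanSpace ℝ (Fin 3) ≃ₗᵢ[ℝ] EuclideanSpace ℝ (Fin 3)) (hstd₀ : StdFrame L₀)
    (htr : ∀ (G : EuclideanSpace ℝ (Fin 3) ≃ₗᵢ[ℝ] EuclideanSpace ℝ (Fin 3)) (d : EuclideanSpace ℝ (Fin 3)),
      ((basalSystem (L.trans S.symm)).Adm G d ∨
        (basalSystem (((ℝ ∙ EuclideanSpace.single (2 : Fin 3) (1 : ℝ)).reflection).trans (L.trans S.symm))).Adm G d) →
      StdFrame G →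
      ((basalSystem L₀).Adm G d ∨
        (basalSystem (((ℝ ∙ EuclideanSpace.single (2 : Fin 3) (1 : ℝ)).reflection).trans L₀)).Adm G d))
    (hmono : ∀ b q : EuclideanSpace ℝ (Fin 3), ∀ G : EuclideanSpace ℝ (Fin 3) ≃ₗᵢ[ℝ] EuclideanSpace ℝ (Fin 3), ∀ d : EuclideanSpace ℝ (Fin 3),
      dist (0 : EuclideanSpace ℝ (Fin 3)) b ≤ 1 → q ∈ shifted S z X → b ∈ shifted S z X →
      ((basalSystem (L.trans S.symm)).Adm G d ∨
        (basalSystem (((ℝ ∙ EuclideanSpace.single (2 : Fin 3) (1 : ℝ)).reflection).trans (L.trans S.symm))).Adm G d) →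
      q - d ∈ shifted S z X → IsEndMove (shifted S z X) WordVersion.v2 G d q b →
        q ∈ exactPos ∧ b ∈ exactPos ∧ ∀ x ∈ shifted S z X, InspectedAt G q b x → x ∈ exactPos) :
    CapturedAt L X z := by
  refine ⟨S, L₀, hstd₀, fun b q hb hpair => ?_⟩
  obtain ⟨hq, hbY, -, G, d, hadm, hqd, hmove⟩ := hpair
  obtain ⟨hqE, hbE, hins⟩ := hmono b q G d hb hq hbY hadm hqd hmove
  have hqE' : q ∈ exactOf (shifted S z X) := mem_exactOf_iff.2 ⟨hq, hqE⟩
  have hbE' : b ∈ exactOf (shifted S z X) := mem_exactOf_iff.2 ⟨hbY, hbE⟩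
  have hins' : ∀ x ∈ shifted S z X, InspectedAt G q b x → x ∈ exactOf (shifted S z X) :=
    fun x hx hi => mem_exactOf_iff.2 ⟨hx, hins x hx hi⟩
  -- the predecessor is inspected: `q − d = q + G w` with `w` a slot
  have hadm' : ∃ w ∈ fccSlots, -d = G w := by
    rcases hadm with h | h
    · exact exists_slot_neg_of_adm h
    · exact exists_slot_neg_of_adm h
  obtain ⟨w, hw, hdw⟩ := hadm'
  have hqdE : q - d ∈ exactOf (shifted S z X) := by
    have e : q - d = q + G w := by rw [sub_eq_add_neg, hdw]
    rw [e] at hqd ⊢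
    exact hins' _ hqd ⟨w, hw, Or.inl rfl⟩
  -- the move descends to the exact part, so the class frame is standard and the class transfers to `L₀`
  have hmoveE : IsEndMove (exactOf (shifted S z X)) WordVersion.v2 G d q b :=
    isEndMove_of_exact (exactOf_subset _) hmove hbE' hins'
  exact ⟨hqE', hbE', G, d, htr G d hadm (stdFrame_of_exact_reader hqE hmoveE), hqdE, hmoveE⟩

/-- **`ModuleCapture` (the deep case of T4's typing half).**  At every payer window of a `1`-separated configuration that is off-site for 𝒰_cx and
mono-module (some placement `S` makes every (A)-end pair near the payer read exact balls), the window is CAPTURED: for the standard frame `L₀`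
of `exists_stdFrame_adm_transfer (L.trans S.symm)`, every (A)-end pair of the joint systems of `L̃` within `1` of the payer is a flat end pair of
the exact part for the joint systems of `L₀`. -/
theorem moduleCapture : ModuleCapture := by
  intro L X _ z _ _ _ hmono
  obtain ⟨S, hmonoS⟩ := hmono
  obtain ⟨L₀, hstd₀, htr⟩ := exists_stdFrame_adm_transfer (L.trans S.symm)
  exact capturedAt_of_mono_of_transfer S L₀ hstd₀ htr hmonoS

end TailResidue

end Summit.Ventures.Crystal3D.Theorems

end
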